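import Literature.MathematicalPhysics.QuantumFieldTheory.Balaban1983to89.B15Prop1RealChartFamilyVelocity
import Literature.MathematicalPhysics.QuantumFieldTheory.Balaban1983to89.B15Prop1RealChartFamilyExplicitB
import Literature.MathematicalPhysics.QuantumFieldTheory.Balaban1983to89.B15Prop1SliceHessianOfChartFamilyB

/-!
# `Balaban1983to89.B15Prop1RealChartFamilyVelocityB` — [Balaban1985Variational] Sect. G (172) p. 305, Prop. 9 (190) p. 309; [Balaban1989LargeFieldI] (1.74) p. 192, (1.77) and Prop. 1 p. 194; [Balaban1989LargeFieldII]
# (1.12) p. 359; [Balaban1988Convergent] (2.12) p. 256; [Balaban1984PropagatorsII] (= [II]) (2.3) p. 224: THE REAL CHART FAMILY WITH ITS VELOCITY LETTER **OVER A BOND-LEVEL DATUM** — the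
# print-datum edition of dag-n12-w5's `B15Prop1RealChartFamilyVelocity` §Main (both datum-bearing declarations used by N12's junction of record v14ᴸ: the generic
# `exists_realChartFamily_velocity_of_minimiserChart` (class (γ), namespace `…B`, same name) and the record edition `exists_realChartFamily_hval_velocity_atRecord` (class (β): here
# `…_atRecordB`, at `bgMSCoPOfRecordB` over a bond-datum family `bd`))

statement-level skeleton of published theorems with citation tags; proofs where landed; nothing here is a claim about
the Yang–Mills mass gap

Cell `pub-ymgap` (HUMAN RULINGS D-0062 ∕ D-0149), lane `pub-ymgap-dag-n12-c` g35 (R134 seat (a), N12 = [B15], s1, lane owner); `--kind proof --supports` K1⁹ `stmt-QuantumFields-27364`;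
count-neutral.  THEOREMS ONLY (0 `def`, 0 `instance`, 0 `sorry`).  (E1) variant (iii-b) of the lane's census-by-declaration (bus [DAGN12C-G35], 2026-08-30).  Proof text VERBATIM over the lane's
`B15Prop1RealChartFamilyExplicitB.realChartFamily_explicit` and `B15Prop1SliceHessianOfChartFamilyB.eventually_sliceFn_fun177stdB_bgMSCoPOfRecordB_eq_wilsonAction4` (✓p770610); the parent's
datum-free velocity calculus (`norm_fderiv_realChartFamily_apply_le`, Cauchy's inequality) REUSED by name.

HONESTY GUARD (director-ym №338 (5)).  PURELY ADDITIVE: the parent stays landed and true on its own text; nothing in it is edited; no displayed premise of any consumer is deleted or weakened.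
Nothing of [15] asserted (the holomorphic minimiser chart is a HYPOTHESIS); count-neutral; N12 NOT discharged; K0⁷ ∕ K1⁹ NOT closed; one finite 𝕋⁴ programme at fixed ε — nothing continuum ∕ ℝ⁴ ∕
OS; the Yang–Mills mass gap (Clay) is NOT proved by any of this.

WHAT IS HERE.  ★★ `exists_realChartFamily_velocity_of_minimiserChart` (over `𝔅 : BDetSet P`) · ★★ `exists_realChartFamily_hval_velocity_atRecordB` (at `bgMSCoPOfRecordB F 2 ν Kt k′ Ω` over `bd`).

References: [15] = [Balaban1985Variational] (2) p.278, (15) p.280, Sect. G (172) p.305, Prop. 9 (190) p.309; [Balaban1989LargeFieldI] (1.74) p.192, (1.77) and Prop. 1 p.194; [Balaban1989LargeFieldII]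
p.359, (1.12) p.359; [III] = [Balaban1988Convergent] (2.12)–(2.14) pp.256–257; [II] = [Balaban1984PropagatorsII] (2.3) p.224.
-/

noncomputable section

open Set Metric Filter
open scoped Topology ContDiff Matrix.Norms.L2Operator ComplexConjugate

namespace Literature.MathematicalPhysics.QuantumFieldTheory.Balaban1983to89.B15Prop1RealChartFamilyVelocityB

open B15SU2ChartHolomorphic (genE logCoordC)
open B15Prop1SliceCoordinates (GaugeSlice ιA norm_ιA_apply_le)
open B15Prop1SliceTaylorCalculus (ιAc cplxSliceL cplxSliceL_apply ιAc_cplxSlice sliceFn)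
open B15Prop1ChartCalculusSU2 (E3)
open T4CubeChartGnomonic (SU2)
open T4Continuum B15DeterminingSets B15DeterminingSetsB GaugeField
open T4AdjointCovarianceUnitary (lieSU)
open Node00
open B16Sect1Backgrounds (expMul expMul_zero)
open B15Prop1AnalyticExtClause (cplxVec norm_cplxVec)
open Literature.MathematicalPhysics.QuantumLattice (quatMatrix)
open T4HaarSU2ExpChart (imQuat norm_imQuat)
open T4QuatExpLog (norm_quatMatrix)
open B15Prop1RealChartFamilyFromMinimiserChart (contDiffOn_matrix_of_entries binders_of_contDiffAt_two)
open B15Prop1LinearisedDatumCoordinates (exists_logCoordCLM hasFDerivAt_logCoordC_one)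
open B15Prop1RealChartFamilyExplicit (norm_trace_genE_mul_star_mul_le norm_euclidean_three_le_two_mul exists_reCoordCLM cplxVec_pair_zero norm_fderiv_apply_le_of_forall_mem_ball)
open B15Prop1ChartSU2 (su2Chart)
open B15Eq177ValueInvariance B14.Eq216Concrete
open B15Prop1RealChartFamilyVelocity (norm_fderiv_realChartFamily_apply_le)
open B15Sect1Instances B14.Eq213DetSet
open B15Prop1SliceHessianOfChartFamily (eventually_sliceFn_fun177stdB_bgMSCoPOfRecordB_eq_wilsonAction4)
open Literature.MathematicalPhysics.QuantumFieldTheory.BalabanImbrieJaffe1984to88.BIJ85Eq453GaugeField (qsstarGIter0)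

variable {P : Params} {k : ℕ} [DecidableEq (PBond P k)]

/-- ★★★ **(K′) WITH ITS VELOCITY (K): THE REAL `C²` MINIMISER CHART FAMILY AND THE BOUND ON ITS DERIVATIVE AT `0`, FROM (J0′)'s THREE CLAUSES.**  Hypotheses =
`B15Prop1RealChartFamilyFromMinimiserChart.exists_realChartFamily_of_minimiserChart` (p608072) VERBATIM plus (J0′)'s SECOND clause — the entrywise bound `‖Ũ z b a c‖ ≤ 𝓐₀` on
`ball 0 R` (`B15Prop1ClosedGuardUniformRadius` `hMinC`∕`hMinK`, second conjunct).  Conclusion: the (K′) package (a base minimiser `U₀`, a real family `X_f` with `X_f 0 = 0`, `C²` at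
`0`, `expChart U₀ (X_f Y)` minimisers near `0`) AND, for every slice vector `X` and every bond `b`, `‖X_f′(0) X (b)‖_op ≤ 8·𝓐₀∕R·‖X‖` and `‖X_f′(0) X (b)‖ ≤ 12·𝓐₀∕R·‖X‖`
(Cauchy's inequality on complex lines through the origin of the chart parameters, `B15Prop1RealChartFamilyExplicit` §1, feeds the chart-velocity letter of §1 with `K₁ = 2𝓐₀∕R`).  This is the letter (K)
«`p (fderiv ℝ X_f 0 X) ≤ K_c‖X‖`» of the assembled endpoint's package (N) (`B15Prop1EndpointNearFlatLetters`, p610003) for the (K′) family, up to the knit's choice of the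
seminorm `p`; `K_c` is per instance through (J0′)'s ONE radius on the compact closed guard — an O(1) constant in [15] (172) («`|H₁|` bounded»), existential in the tree.
[cite: Balaban1985Variational, Thm 1 p.279, (15) p.280, Sect. G (172) p.305, Prop. 9 (190) p.309; Balaban1988Convergent, (2.12)–(2.14) pp.256–257; Balaban1989LargeFieldI, Prop. 1 p.194 (last clause); Balaban1989LargeFieldII, (1.12) p.359, (1.19) p.360; HormanderSCV1973, Thm 2.2.7] -/
theorem exists_realChartFamily_velocity_of_minimiserChart (S : Set (Site P k)) (T : Finset (PBond P k))
    (φ : EuclideanSpace ℝ (Fin 3) →ₗ[ℝ] lieSU (Fin 2)) (hφ : ∀ v, ((φ v : lieSU (Fin 2)) : Matrix (Fin 2) (Fin 2) ℂ) = quatMatrix (imQuat v))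
    (av : ∀ j, Averaging P j SU2) (reg : Set (GaugeField P 0 SU2)) (𝔅 : BDetSet P)
    (ext : GaugeField P k SU2 → GaugeField P k SU2) (Vk : GaugeField P k SU2) {R : ℝ} (hR : 0 < R)
    (Ũ : VecField P k (EuclideanSpace ℂ (Fin 3)) × VecField P k (EuclideanSpace ℂ (Fin 3)) → PBond P 0 → Matrix (Fin 2) (Fin 2) ℂ)
    (hdiff : ∀ b a c, DifferentiableOn ℂ (fun z => Ũ z b a c) (ball 0 R))
    {𝓐₀ : ℝ} (h𝓐 : ∀ z ∈ ball (0 : VecField P k (EuclideanSpace ℂ (Fin 3)) × VecField P k (EuclideanSpace ℂ (Fin 3))) R, ∀ b a c, ‖Ũ z b a c‖ ≤ 𝓐₀)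
    (hreal : ∀ p B' : VecField P k E3, ‖p‖ < R → ‖B'‖ < R → ∃ U' : GaugeField P 0 SU2,
      (∀ b, Ũ (cplxVec p, cplxVec B') b = ((U' b : SU2) : Matrix (Fin 2) (Fin 2) ℂ)) ∧
        IsMinimizerB av reg 𝔅 (avgFamily av (qsstarGIter0 k (expMul su2Chart B' (ext (expMul su2Chart p Vk))))) U') :
    ∃ U₀ : GaugeField P 0 SU2, ∃ Xf : GaugeSlice S T E3 → PBond P 0 → lieSU (Fin 2),
      Xf 0 = 0 ∧ ContDiffAt ℝ 2 Xf 0 ∧ IsMinimizerB av reg 𝔅 (avgFamily av (qsstarGIter0 k (ext Vk))) U₀ ∧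
        (∀ᶠ Y in 𝓝 (0 : GaugeSlice S T E3),
          IsMinimizerB av reg 𝔅 (avgFamily av (qsstarGIter0 k (expMul su2Chart (ιA S T Y) (ext Vk)))) (expChart U₀ (Xf Y))) ∧
        ∀ (X : GaugeSlice S T E3) (b : PBond P 0),
          ‖((fderiv ℝ Xf 0 X b : lieSU (Fin 2)) : Matrix (Fin 2) (Fin 2) ℂ)‖ ≤ 8 * 𝓐₀ / R * ‖X‖ ∧ ‖fderiv ℝ Xf 0 X b‖ ≤ 12 * 𝓐₀ / R * ‖X‖ := by
  -- the base minimiser: the `hreal` witness at `(p, B′) = (0, 0)`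
  have h0R : ‖(0 : VecField P k E3)‖ < R := by simpa using hR
  obtain ⟨U₀, hU₀eq, hU₀min⟩ := hreal 0 0 h0R h0R
  rw [expMul_zero, expMul_zero] at hU₀min
  -- the explicit family and its three clauses
  set Xf : GaugeSlice S T E3 → PBond P 0 → lieSU (Fin 2) := fun Y b => φ (WithLp.toLp 2 fun a =>
      (logCoordC (star ((U₀ b : SU2) : Matrix (Fin 2) (Fin 2) ℂ) * Ũ (cplxVec (0 : VecField P k E3), cplxVec (ιA S T Y)) b) a).re) with hXf
  obtain ⟨h0, h2, hmin⟩ := B15Prop1RealChartFamilyExplicitB.realChartFamily_explicit S T φ hφ av reg 𝔅 ext Vk hR Ũ hdiff hreal U₀ hU₀eq Xf hXf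
  -- the chart-velocity letter by Cauchy's inequality, `K₁ = 2𝓐₀/R`
  have hvel : ∀ b a c (v : VecField P k (EuclideanSpace ℂ (Fin 3)) × VecField P k (EuclideanSpace ℂ (Fin 3))),
      ‖fderiv ℂ (fun z => Ũ z b a c) 0 v‖ ≤ 2 * 𝓐₀ / R * ‖v‖ := fun b a c v =>
    norm_fderiv_apply_le_of_forall_mem_ball hR (hdiff b a c) (fun z hz => h𝓐 z hz b a c) v
  refine ⟨U₀, Xf, h0, h2, hU₀min, hmin, fun X b => ?_⟩
  have h𝓐0 : 0 ≤ 𝓐₀ := (norm_nonneg _).trans (h𝓐 0 (mem_ball_self hR) b 0 0)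
  have hK₁ : 0 ≤ 2 * 𝓐₀ / R := by positivity
  obtain ⟨hop, hhs⟩ := norm_fderiv_realChartFamily_apply_le S T φ hφ U₀ hR Ũ hdiff hU₀eq Xf hXf hK₁ hvel X b
  constructor
  · calc ‖((fderiv ℝ Xf 0 X b : lieSU (Fin 2)) : Matrix (Fin 2) (Fin 2) ℂ)‖ ≤ 4 * (2 * 𝓐₀ / R) * ‖X‖ := hop
      _ = 8 * 𝓐₀ / R * ‖X‖ := by ring
  · calc ‖fderiv ℝ Xf 0 X b‖ ≤ 6 * (2 * 𝓐₀ / R) * ‖X‖ := hhs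
      _ = 12 * 𝓐₀ / R * ‖X‖ := by ring

/-- ★★ **THE RECORD EDITION WITH VELOCITY — THE SHAPE THE ASSEMBLED ENDPOINT's `hNF` CONSUMES.**  At the endpoints' objects (NODE 00's averaging `avOfRecord F 2 Kt`, class
`regMSCoPOfRecord F 2 ν Kt k′ Ω`, determining set `𝐁_k(Z) = Bj M₁ Z k`): from (J0′)'s three clauses at one base field `Ṽ_k` — the family `(U₀, X_f)` with `X_f 0 = 0`, `C²` at `0`, its
binder triple, the base minimiser, the minimiser property near `0`, print's value identity along the slice `sliceFn S T (fun177std (bgMSCoPOfRecord …) M₁ Z k) Ṽ_k Y = A(expChart U₀ (X_f Y))`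
(`B15Prop1RealChartFamilyFromMinimiserChart` (c3) ∕ the lane's `eventually_sliceFn_fun177std_bgMSCoPOfRecord_eq_wilsonAction4`), AND the velocity letter (K) per bond in both matrix
currencies (`≤ 8·𝓐₀∕R·‖X‖` operator, `≤ 12·𝓐₀∕R·‖X‖` Hilbert–Schmidt).  Conjuncts 2–4 + (K) of `hNF` in `B15Prop1EndpointNearFlatLetters` (p610003) for the (K′) family, modulo the
knit's seminorm dictionary `p ≤ c·‖·‖`. [cite: Balaban1989LargeFieldI, (1.74) p.192, (1.77) and Prop. 1 p.194; Balaban1989LargeFieldII, p.359, (1.12) p.359; Balaban1988Convergent, (2.12) p.256; Balaban1985Variational, (2) p.278, Sect. G (172) p.305, Prop. 9 (190) p.309] -/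
theorem exists_realChartFamily_hval_velocity_atRecordB {F : T4Family} (ν : Stage7Numerics) (Kt k' : ℕ) (Ω : ℕ → Set (Site (F.P Kt) 0))
    (M₁ : ℕ) (bd : ℕ → (ℕ → Set (Site (F.P Kt) 0)) → BDetSet (F.P Kt)) (Z : Set (Site (F.P Kt) 0)) {k : ℕ} [DecidableEq (PBond (F.P Kt) k)] (S : Set (Site (F.P Kt) k)) (T : Finset (PBond (F.P Kt) k))
    (φ : EuclideanSpace ℝ (Fin 3) →ₗ[ℝ] lieSU (Fin 2)) (hφ : ∀ v, ((φ v : lieSU (Fin 2)) : Matrix (Fin 2) (Fin 2) ℂ) = quatMatrix (imQuat v))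
    (ext : GaugeField (F.P Kt) k SU2 → GaugeField (F.P Kt) k SU2) (Vk : GaugeField (F.P Kt) k SU2) {R : ℝ} (hR : 0 < R)
    (Ũ : VecField (F.P Kt) k (EuclideanSpace ℂ (Fin 3)) × VecField (F.P Kt) k (EuclideanSpace ℂ (Fin 3)) →
      PBond (F.P Kt) 0 → Matrix (Fin 2) (Fin 2) ℂ)
    (hdiff : ∀ b a c, DifferentiableOn ℂ (fun z => Ũ z b a c) (ball 0 R))
    {𝓐₀ : ℝ} (h𝓐 : ∀ z ∈ ball (0 : VecField (F.P Kt) k (EuclideanSpace ℂ (Fin 3)) × VecField (F.P Kt) k (EuclideanSpace ℂ (Fin 3))) R,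
      ∀ b a c, ‖Ũ z b a c‖ ≤ 𝓐₀)
    (hreal : ∀ p B' : VecField (F.P Kt) k E3, ‖p‖ < R → ‖B'‖ < R → ∃ U' : GaugeField (F.P Kt) 0 SU2,
      (∀ b, Ũ (cplxVec p, cplxVec B') b = ((U' b : SU2) : Matrix (Fin 2) (Fin 2) ℂ)) ∧
        IsMinimizerB (avOfRecord F 2 Kt) (regMSCoPOfRecord F 2 ν Kt k' Ω) (bd k (maxDomT M₁ Z))
          (avgFamily (avOfRecord F 2 Kt) (qsstarGIter0 k (expMul su2Chart B' (ext (expMul su2Chart p Vk))))) U') :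
    ∃ U₀ : GaugeField (F.P Kt) 0 SU2, ∃ Xf : GaugeSlice S T E3 → PBond (F.P Kt) 0 → lieSU (Fin 2),
      Xf 0 = 0 ∧ ContDiffAt ℝ 2 Xf 0 ∧
      HasFDerivAt Xf (fderiv ℝ Xf 0) 0 ∧ HasFDerivAt (fun Y => fderiv ℝ Xf Y) (fderiv ℝ (fderiv ℝ Xf) 0) 0 ∧
      (∀ᶠ Y in 𝓝 (0 : GaugeSlice S T E3), DifferentiableAt ℝ Xf Y) ∧
      IsMinimizerB (avOfRecord F 2 Kt) (regMSCoPOfRecord F 2 ν Kt k' Ω) (bd k (maxDomT M₁ Z)) (avgFamily (avOfRecord F 2 Kt) (qsstarGIter0 k (ext Vk))) U₀ ∧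
      (∀ᶠ Y in 𝓝 (0 : GaugeSlice S T E3),
          IsMinimizerB (avOfRecord F 2 Kt) (regMSCoPOfRecord F 2 ν Kt k' Ω) (bd k (maxDomT M₁ Z))
            (avgFamily (avOfRecord F 2 Kt) (qsstarGIter0 k (expMul su2Chart (ιA S T Y) (ext Vk)))) (expChart U₀ (Xf Y))) ∧
      (∀ᶠ Y in 𝓝 (0 : GaugeSlice S T E3),
          sliceFn S T (fun177stdB (bgMSCoPOfRecordB F 2 ν Kt k' Ω) M₁ bd Z k) (ext Vk) Y = wilsonAction4 (expChart U₀ (Xf Y))) ∧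
        ∀ (X : GaugeSlice S T E3) (b : PBond (F.P Kt) 0),
          ‖((fderiv ℝ Xf 0 X b : lieSU (Fin 2)) : Matrix (Fin 2) (Fin 2) ℂ)‖ ≤ 8 * 𝓐₀ / R * ‖X‖ ∧ ‖fderiv ℝ Xf 0 X b‖ ≤ 12 * 𝓐₀ / R * ‖X‖ := by
  obtain ⟨U₀, Xf, h0, h2, hmin0, hmin, hvel⟩ :=
    exists_realChartFamily_velocity_of_minimiserChart S T φ hφ (avOfRecord F 2 Kt) (regMSCoPOfRecord F 2 ν Kt k' Ω) (bd k (maxDomT M₁ Z))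
      ext Vk hR Ũ hdiff h𝓐 hreal
  obtain ⟨hd1, hd2, hdd⟩ := binders_of_contDiffAt_two h2
  exact ⟨U₀, Xf, h0, h2, hd1, hd2, hdd, hmin0, hmin,
    eventually_sliceFn_fun177stdB_bgMSCoPOfRecordB_eq_wilsonAction4 ν Kt k' Ω M₁ bd Z S T (ext Vk) hmin, hvel⟩

end Literature.MathematicalPhysics.QuantumFieldTheory.Balaban1983to89.B15Prop1RealChartFamilyVelocityB

end
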